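import Summits.MatrixMultiplication.MatrixMultiplication.Theorems.SoloInformedCwTwoNurmievThreeCharTwo
import HarnessLib

/-!
# `N₁ ⊵ N₂` in characteristic `2` (the top edge of the char-`2` Hasse diagram)

Solo programme `solo-MatrixMultiplication-informed`, generation 27.  Over `ℂ` the nilpotent class
`N₁` (orbit dimension `24`, the largest on Nurmiev's list) should degenerate to `N₂` (dimension `23`),
but no monomial / small-integer certificate was found by our searches, so the pair `(1, 2)` is one
of the `19` pairs left open over `ℂ` in `SoloInformedNullconeHasse`.  MODULO `2` an order-`2`
certificate exists (kissat on a native `𝔽₂` encoding, job j197403, 44 s; verified independently):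
`A = (1, ε, 0; 1, 0, 0; 1, 0, ε²)`, `B = (1, ε, 0; 1, 0, 0; 1, ε, ε²)`, `C = (1, 0, 0; 1, 1, ε; 1, 1, 0)`
(rows = source index, columns = target index, entries as polynomials in `ε`), i.e.
`(A ⊗ B ⊗ C)·N₁ ≡ ε² N₂ + O(ε³) (mod 2)`.  Read over `ℤ` the same matrices give
`6·e₀₀₀ + 4·e₀₀₁ + …` in low order, so this is a characteristic-`2` phenomenon of the certificate
(no sign pattern lifts it to `ℤ`: all `2¹⁷` checked), not necessarily of the relation.

* `nurmiev_1_2_mod2_check` — the certificate, by `decide +kernel` through `DegenCert.checkMod`;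
* `nurmiev_one_polyDegeneratesTo_nurmiev_two_of_two_eq_zero` — **`N₁ ⊵ N₂` over every
  commutative ring with `2 = 0`**; with `char_two_relations_above_three` and the every-ring covers
  this makes `N₁` the top of the known characteristic-`2` order as well.
Sources: [cite: Nurmiev2000, Table 2].  Everything here is PROVED; no new axioms.
-/

namespace Summit.MatrixMultiplication.MatrixMultiplication.Theorems.NullconeHasse

open Literature.Computability.AlgebraicComplexity
open Literature.Barriers.MatrixMultiplication (PolyDegeneratesTo)
open Summit.MatrixMultiplication.MatrixMultiplication.Theorems

/-- `N₁ ⊵ N₂` at order `2` MODULO `2` (kissat, job j197403; verified independently).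
[cite: Nurmiev2000, Table 2] -/
theorem nurmiev_1_2_mod2_check :
    DegenCert.checkMod 2 3 3 3 3 3 3 2 (nurmievInt 1) (nurmievInt 2)
      ![![[1], [0, 1], []], ![[1], [], []], ![[1], [], [0, 0, 1]]]
      ![![[1], [0, 1], []], ![[1], [], []], ![[1], [0, 1], [0, 0, 1]]]
      ![![[1], [], []], ![[1], [1], [0, 1]], ![[1], [1], []]]
      = true := by
  decide +kernel

/-- **`N₁ ⊵ N₂` over every commutative ring of characteristic `2`.** [cite: Nurmiev2000, Table 2] -/
theorem nurmiev_one_polyDegeneratesTo_nurmiev_two_of_two_eq_zero (K : Type*) [CommRing K]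
    (h2 : (2 : K) = 0) : PolyDegeneratesTo (nurmiev K 1) (nurmiev K 2) :=
  DegenCert.polyDegeneratesTo_of_checkMod K (p := 2) (by exact_mod_cast h2) nurmiev_1_2_mod2_check

end Summit.MatrixMultiplication.MatrixMultiplication.Theorems.NullconeHasse
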